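import Summits.Ventures.CertifiedArithmetic.LowPrec.MXQuantize
import Summits.Ventures.CertifiedArithmetic.LowPrec.Round
import Literature.ComputerArithmetic.FloatingPoint.Formats

/-!
# The CLIPPING atom of the OCP floor scale rule (envelope tables, MX-floor row)

HONEST FRAMING (venture CertifiedArithmetic / cell `pub-lowprec`): certified error envelopes and
provably optimal rounding/accumulation schemes for low-precision formats under stated cost models;
every table by two implementations; no hardware or vendor claims.

The OCP MX v1.0 scale rule `X = 2^(⌊log₂ amax⌋ - emaxElem)` (`MXBlock.scaleRat`,
[RouhaniEtAl2023MX, §3 Alg. 1]) puts the scaled block maximum in the top binade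
`[2^emaxElem, 2^(emaxElem+1))` (`MXBlock.scaled_blockMax_mem_top_binade`), so elements with
`maxRat < |Vᵢ|/X` are CLIPPED to `±maxRat` by the saturating `roundNE`. This file proves the
per-element atom of that regime (cell `envelope/THEOREM-SHAPES.md` §4.0, MX-floor row; certificate
C56 `certs/enum/ENVELOPE-ATOMS.json`, cells MX-·-floor `j = 0`):

* `MiniFloat.abs_sub_roundNE_of_maxRat_le`: for `maxRat ≤ |x|` the error of the saturating
  rounding is exactly `|x| - maxRat`;
* `mxFloorClampAtom`: a clipped element is reproduced with error `< (1 - maxRat/2^(emaxElem+1))·|Vᵢ|`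
  — STRICT: the supremum `1 - maxRat/2^(emaxElem+1)` (E4M3 `1/8`, E5M2 `1/8`, E2M1 `1/4`, E3M2
  `1/8`, E2M3 `1/16`: `floorClampUnit_values`) is approached as `|Vᵢ|/X ↑ 2^(emaxElem+1)` and never
  attained (the C56 classification "sup, not max"; bf16 witness `510 ↦ 448`, ratio `31/255 < 1/8`);
* `mxFloorClampAtom_blockMax`: the non-strict form relative to the block maximum.

References: [RouhaniEtAl2023MX] §3; [MicikeviciusEtAl2022] Table 1; [IEEE7542019] §4.3.1, §7.4
(saturation semantics as modelled by `roundNE`).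

Placement: venture development under `Summits/Ventures/CertifiedArithmetic/`; the datum-level
lemma is a dot-notation extension of the Literature structure `MiniFloat` (CONVENTIONS §2); the
block-level atom lives in `Summit.Ventures.CertifiedArithmetic.LowPrec.EnvelopeAtoms`.
-/

namespace Literature.ComputerArithmetic.FloatingPoint

namespace MiniFloat

variable {φ : Format}

/-- SATURATION ERROR IN CLOSED FORM: if `maxRat ≤ |x|` then `roundNE φ x = ±maxRat` with the sign
of `x`, so `|x - fl x| = |x| - maxRat`. [cite: IEEE7542019, §7.4] -/
theorem abs_sub_roundNE_of_maxRat_le {x : ℚ} (h : φ.maxRat ≤ |x|) :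
    |x - (roundNE φ x).toRat| = |x| - φ.maxRat := by
  have hq := φ.quantum_pos
  have hmag := abs_toRat_roundNE_of_maxRat_le (φ := φ) h
  have hform := toRat_roundNE (φ := φ) x
  by_cases hx : x < 0
  · rw [if_pos hx] at hform
    have hnonpos : (roundNE φ x).toRat ≤ 0 := by
      rw [hform, neg_mul]
      exact neg_nonpos.mpr (mul_nonneg (Nat.cast_nonneg _) hq.le)
    have hval : (roundNE φ x).toRat = -φ.maxRat := by
      rw [abs_of_nonpos hnonpos] at hmag; linarith
    rw [abs_of_neg hx] at h ⊢
    rw [hval, show x - -φ.maxRat = x + φ.maxRat by ring, abs_of_nonpos (by linarith)]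
    ring
  · rw [if_neg hx] at hform
    have hnonneg : 0 ≤ (roundNE φ x).toRat := by
      rw [hform]; exact mul_nonneg (Nat.cast_nonneg _) hq.le
    have hval : (roundNE φ x).toRat = φ.maxRat := by
      rw [abs_of_nonneg hnonneg] at hmag; exact hmag
    rw [abs_of_nonneg (not_lt.mp hx)] at h ⊢
    rw [hval, abs_of_nonneg (by linarith)]

end MiniFloat

end Literature.ComputerArithmetic.FloatingPoint

namespace Summit.Ventures.CertifiedArithmetic.LowPrec.EnvelopeAtoms

open Literature.ComputerArithmetic.FloatingPoint
open Literature.ComputerArithmetic.FloatingPoint.Format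
open Literature.ComputerArithmetic.FloatingPoint.MiniFloat
open Literature.ComputerArithmetic.FloatingPoint.MXBlock

/-- FLOOR-RULE CLIPPING ATOM (strict): in an MX block with the OCP floor scale `X = scaleRat φ V`,
an element that clips (`maxRat < |Vᵢ| / X`) is reproduced with error
`|Vᵢ| - maxRat·X < (1 - maxRat / 2^(emaxElem+1)) · |Vᵢ|`, because `|Vᵢ| / X < 2^(emaxElem+1)`.
[cite: RouhaniEtAl2023MX, §3] -/
theorem mxFloorClampAtom (φ : Format) (k : ℕ) (V : Fin k → ℚ) (i : Fin k) (hM : 0 < φ.maxRat)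
    (hB : 0 < blockMax V) (hclamp : φ.maxRat < |V i| / scaleRat φ V) :
    |V i - scaleRat φ V * (roundNE φ (V i / scaleRat φ V)).toRat|
      < (1 - φ.maxRat / 2 ^ (φ.emaxElem + 1)) * |V i| := by
  have hX := scaleRat_pos φ V
  have hP : (0 : ℚ) < 2 ^ (φ.emaxElem + 1) := zpow_pos (by norm_num) _
  have habs : |V i / scaleRat φ V| = |V i| / scaleRat φ V := by rw [abs_div, abs_of_pos hX]
  have herr := abs_sub_roundNE_of_maxRat_le (φ := φ) (x := V i / scaleRat φ V)
    (by rw [habs]; exact hclamp.le)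
  have hfac : V i - scaleRat φ V * (roundNE φ (V i / scaleRat φ V)).toRat
      = scaleRat φ V * (V i / scaleRat φ V - (roundNE φ (V i / scaleRat φ V)).toRat) := by
    rw [mul_sub, mul_div_cancel₀ _ (ne_of_gt hX)]
  rw [hfac, abs_mul, abs_of_pos hX, herr, habs, mul_sub, mul_div_cancel₀ _ (ne_of_gt hX)]
  -- goal: |V i| - X * maxRat < (1 - maxRat / 2^(e+1)) * |V i|
  have hlt : |V i| < 2 ^ (φ.emaxElem + 1) * scaleRat φ V := by
    have := scaled_lt_pow φ V hB i
    rwa [div_lt_iff₀ hX] at this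
  have key : φ.maxRat / 2 ^ (φ.emaxElem + 1) * |V i| < φ.maxRat * scaleRat φ V := by
    rw [div_mul_eq_mul_div, div_lt_iff₀ hP]
    calc φ.maxRat * |V i| < φ.maxRat * (2 ^ (φ.emaxElem + 1) * scaleRat φ V) :=
          mul_lt_mul_of_pos_left hlt hM
      _ = φ.maxRat * scaleRat φ V * 2 ^ (φ.emaxElem + 1) := by ring
  nlinarith

/-- FLOOR-RULE CLIPPING ATOM relative to the block maximum (non-strict): a clipped element's
error is at most `(1 - maxRat / 2^(emaxElem+1)) · blockMax V`. [cite: RouhaniEtAl2023MX, §3] -/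
theorem mxFloorClampAtom_blockMax (φ : Format) (k : ℕ) (V : Fin k → ℚ) (i : Fin k)
    (h1 : 1 ≤ φ.emaxCode) (hB : 0 < blockMax V) (hclamp : φ.maxRat < |V i| / scaleRat φ V) :
    |V i - scaleRat φ V * (roundNE φ (V i / scaleRat φ V)).toRat|
      ≤ (1 - φ.maxRat / 2 ^ (φ.emaxElem + 1)) * blockMax V := by
  have hM : 0 < φ.maxRat :=
    lt_of_lt_of_le (zpow_pos (by norm_num) _) (Format.pow_emaxElem_le_maxRat φ h1)
  have hc : 0 ≤ 1 - φ.maxRat / 2 ^ (φ.emaxElem + 1) := by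
    have hP : (0 : ℚ) < 2 ^ (φ.emaxElem + 1) := zpow_pos (by norm_num) _
    have := Format.maxRat_lt_pow_emaxElem φ h1
    rw [sub_nonneg, div_le_one hP]; exact this.le
  exact le_trans (mxFloorClampAtom φ k V i hM hB hclamp).le
    (mul_le_mul_of_nonneg_left (abs_le_blockMax V i) hc)

/-- The clipping atom `1 - maxRat / 2^(emaxElem+1)` of the element formats: `1/8` (E4M3:
`1 - 448/512`), `1/8` (E5M2: `1 - 57344/65536`), `1/4` (E2M1: `1 - 6/8`), `1/8` (E3M2:
`1 - 28/32`), `1/16` (E2M3: `1 - 7.5/8`). [cite: MicikeviciusEtAl2022, Table 1] -/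
theorem floorClampUnit_values :
    1 - E4M3.maxRat / 2 ^ (E4M3.emaxElem + 1) = 1 / 8 ∧
    1 - E5M2.maxRat / 2 ^ (E5M2.emaxElem + 1) = 1 / 8 ∧
    1 - E2M1.maxRat / 2 ^ (E2M1.emaxElem + 1) = 1 / 4 ∧
    1 - E3M2.maxRat / 2 ^ (E3M2.emaxElem + 1) = 1 / 8 ∧
    1 - E2M3.maxRat / 2 ^ (E2M3.emaxElem + 1) = 1 / 16 := by
  refine ⟨by decide +kernel, by decide +kernel, by decide +kernel, by decide +kernel,
    by decide +kernel⟩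

/-- The C56 witness of the unattained supremum (route B-1, MX-E4M3-floor, top binade): the
bfloat16 block maximum `510` has floor scale `X = 2^(⌊log₂ 510⌋ - 8) = 1`, clips to `448`, and
its relative error `62/510 = 31/255` stays strictly below the supremum `1/8` — `roundNE`
evaluated in the kernel. [cite: MicikeviciusEtAl2022, Table 1] -/
theorem floorClamp_witness_E4M3 :
    (roundNE E4M3 510).toRat = 448 ∧ |(510 : ℚ) - 448| / 510 = 31 / 255 ∧
      (31 : ℚ) / 255 < 1 / 8 := by
  refine ⟨by decide +kernel, by norm_num, by norm_num⟩

end Summit.Ventures.CertifiedArithmetic.LowPrec.EnvelopeAtoms
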